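import Mathlib

/-!
# Geometric grids and block decompositions of finite sums

Elementary bookkeeping used when a sum over an interval of integers is cut into consecutive blocks
whose endpoints grow geometrically (fine "boxes" of ratio `1 + κ`), as in dispersion-method
arguments (here: the middle range of the linear pair window of the Möbius tail, crux `PolyMobiusTail`):

* `sum_Ioc_eq_sum_range_blocks` — a sum over `Ioc (b 0) (b S)` as the sum of its consecutive blocks;
* the grid `s ↦ min T ⌊B (1+κ)^s⌋₊`: monotone, starts at `B`, reaches `T` after
  `⌈log (T/B) / log (1+κ)⌉₊ ≤ 2 log T / κ + 1` steps, consecutive ratio `≤ (1+κ) · + 2`;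
* `tripleSum_decomp` — a triple sum over `[1,Xb]³` whose summand vanishes unless `BP < d₀ ≤ TP` and
  `m ≤ TM` splits into the part `m ≤ M₀` plus the box sums over the two grids;
* eventual inequalities `C (1 + log x)^k ≤ x^s` along the naturals.

Everything here is PROVED (theorems only).
-/

open Finset Real Filter

namespace Literature.NumberTheory.Sieve

namespace GeometricGrid


/-- Sum over `Ioc (b 0) (b S)` as the sum over the consecutive blocks `Ioc (b s) (b (s+1))` of a
monotone sequence `b`. [folklore] -/
theorem sum_Ioc_eq_sum_range_blocks {M : Type*} [AddCommMonoid M] (b : ℕ → ℕ) (hb : Monotone b)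
    (g : ℕ → M) (S : ℕ) :
    ∑ d ∈ Ioc (b 0) (b S), g d = ∑ s ∈ range S, ∑ d ∈ Ioc (b s) (b (s + 1)), g d := by
  induction S with
  | zero => simp
  | succ S ih =>
      rw [sum_range_succ, ← ih]
      exact (sum_Ioc_consecutive g (hb (Nat.zero_le S)) (hb (Nat.le_succ S))).symm

/-- The geometric grid: `min T ⌊B (1+κ)^s⌋₊` is monotone in `s` (for `κ ≥ 0`). [folklore] -/
theorem grid_monotone (B T : ℕ) {κ : ℝ} (hκ : 0 ≤ κ) :
    Monotone (fun s : ℕ => min T ⌊(B : ℝ) * (1 + κ) ^ s⌋₊) := by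
  intro s t hst
  refine min_le_min le_rfl (Nat.floor_le_floor ?_)
  exact mul_le_mul_of_nonneg_left (pow_le_pow_right₀ (by linarith) hst) (Nat.cast_nonneg B)

/-- The grid starts at `B` (when `B ≤ T`). [folklore] -/
theorem grid_zero {B T : ℕ} (hBT : B ≤ T) (κ : ℝ) :
    min T ⌊(B : ℝ) * (1 + κ) ^ 0⌋₊ = B := by
  simp [hBT]

/-- The grid reaches `T` after `S` steps as soon as `T ≤ B (1+κ)^S`. [folklore] -/
theorem grid_top {B T S : ℕ} {κ : ℝ} (h : (T : ℝ) ≤ (B : ℝ) * (1 + κ) ^ S) :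
    min T ⌊(B : ℝ) * (1 + κ) ^ S⌋₊ = T := by
  refine min_eq_left ?_
  exact Nat.le_floor h

/-- One grid step grows by a factor at most `1 + κ`, up to `+2`:
`b (s+1) ≤ (1+κ) · b s + 2`. [folklore] -/
theorem grid_succ_le {B T : ℕ} {κ : ℝ} (hκ : 0 ≤ κ) (hκ1 : κ ≤ 1) (s : ℕ) :
    ((min T ⌊(B : ℝ) * (1 + κ) ^ (s + 1)⌋₊ : ℕ) : ℝ) ≤
      (1 + κ) * ((min T ⌊(B : ℝ) * (1 + κ) ^ s⌋₊ : ℕ) : ℝ) + 2 := by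
  have h1κ : (1 : ℝ) ≤ 1 + κ := by linarith
  have hy0 : 0 ≤ (B : ℝ) * (1 + κ) ^ s := by positivity
  by_cases hT : T ≤ ⌊(B : ℝ) * (1 + κ) ^ s⌋₊
  · -- already saturated at step `s`
    rw [min_eq_left hT]
    have : ((min T ⌊(B : ℝ) * (1 + κ) ^ (s + 1)⌋₊ : ℕ) : ℝ) ≤ T := by
      exact_mod_cast min_le_left _ _
    have hT0 : (0 : ℝ) ≤ T := Nat.cast_nonneg T
    nlinarith
  · push Not at hT
    rw [min_eq_right hT.le]
    have hfl : (B : ℝ) * (1 + κ) ^ s < (⌊(B : ℝ) * (1 + κ) ^ s⌋₊ : ℝ) + 1 := Nat.lt_floor_add_one _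
    calc ((min T ⌊(B : ℝ) * (1 + κ) ^ (s + 1)⌋₊ : ℕ) : ℝ)
        ≤ (⌊(B : ℝ) * (1 + κ) ^ (s + 1)⌋₊ : ℝ) := by exact_mod_cast min_le_right _ _
      _ ≤ (B : ℝ) * (1 + κ) ^ (s + 1) := Nat.floor_le (by positivity)
      _ = (1 + κ) * ((B : ℝ) * (1 + κ) ^ s) := by ring
      _ ≤ (1 + κ) * ((⌊(B : ℝ) * (1 + κ) ^ s⌋₊ : ℝ) + 1) :=
          mul_le_mul_of_nonneg_left hfl.le (by linarith)
      _ ≤ (1 + κ) * (⌊(B : ℝ) * (1 + κ) ^ s⌋₊ : ℝ) + 2 := by nlinarith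

/-- Number of steps needed: with `S = ⌈log (T/B) / log (1+κ)⌉₊` (and `1 ≤ B ≤ T`, `0 < κ`) one has
`T ≤ B (1+κ)^S`. [folklore] -/
theorem le_grid_pow {B T : ℕ} (hB : 1 ≤ B) (hBT : B ≤ T) {κ : ℝ} (hκ : 0 < κ) :
    (T : ℝ) ≤ (B : ℝ) * (1 + κ) ^ ⌈Real.log ((T : ℝ) / B) / Real.log (1 + κ)⌉₊ := by
  have hB0 : (0 : ℝ) < B := by exact_mod_cast hB
  have hT0 : (0 : ℝ) < T := by exact_mod_cast (hB.trans hBT)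
  have hlog : 0 < Real.log (1 + κ) := Real.log_pos (by linarith)
  set S : ℕ := ⌈Real.log ((T : ℝ) / B) / Real.log (1 + κ)⌉₊ with hS
  have hS' : Real.log ((T : ℝ) / B) / Real.log (1 + κ) ≤ S := Nat.le_ceil _
  have h1 : Real.log ((T : ℝ) / B) ≤ S * Real.log (1 + κ) := by
    rwa [div_le_iff₀ hlog] at hS'
  have h2 : (T : ℝ) / B ≤ (1 + κ) ^ S := by
    rw [← Real.log_le_log_iff (by positivity) (by positivity), Real.log_pow]
    exact h1
  rw [div_le_iff₀ hB0] at h2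
  linarith [h2]

/-- Step count bound: `⌈log (T/B) / log (1+κ)⌉₊ ≤ 2 log T / κ + 1` for `1 ≤ B ≤ T`, `0 < κ ≤ 1`
(`log (1+κ) ≥ κ/2`). [folklore] -/
theorem ceil_log_div_le {B T : ℕ} (hB : 1 ≤ B) (hBT : B ≤ T) {κ : ℝ} (hκ : 0 < κ) (hκ1 : κ ≤ 1) :
    (⌈Real.log ((T : ℝ) / B) / Real.log (1 + κ)⌉₊ : ℝ) ≤ 2 * Real.log T / κ + 1 := by
  have hB0 : (0 : ℝ) < B := by exact_mod_cast hB
  have hB1 : (1 : ℝ) ≤ B := by exact_mod_cast hB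
  have hT1 : (1 : ℝ) ≤ T := by exact_mod_cast (hB.trans hBT)
  have hlog : 0 < Real.log (1 + κ) := Real.log_pos (by linarith)
  -- `log (1+κ) ≥ κ/2` on `(0,1]`: from `log y ≥ 1 - 1/y` with `y = 1+κ`: `1 - 1/(1+κ) = κ/(1+κ) ≥ κ/2`.
  have hlk : κ / 2 ≤ Real.log (1 + κ) := by
    have h := Real.one_sub_inv_le_log_of_pos (show (0 : ℝ) < 1 + κ by linarith)
    have h2 : κ / 2 ≤ 1 - (1 + κ)⁻¹ := by
      rw [div_le_iff₀ (by norm_num : (0 : ℝ) < 2)]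
      field_simp
      nlinarith
    linarith
  have hnum : Real.log ((T : ℝ) / B) ≤ Real.log T := by
    rw [Real.log_div (by positivity) (by positivity)]
    linarith [Real.log_nonneg hB1]
  have hnum0 : 0 ≤ Real.log ((T : ℝ) / B) := Real.log_nonneg (by rw [le_div_iff₀ hB0]; simpa using (show (B:ℝ) ≤ T by exact_mod_cast hBT))
  have hq : Real.log ((T : ℝ) / B) / Real.log (1 + κ) ≤ 2 * Real.log T / κ := by
    calc Real.log ((T : ℝ) / B) / Real.log (1 + κ) ≤ Real.log T / (κ / 2) :=
          div_le_div₀ (Real.log_nonneg hT1) hnum (by positivity) hlk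
      _ = 2 * Real.log T / κ := by field_simp
  have hq0 : 0 ≤ Real.log ((T : ℝ) / B) / Real.log (1 + κ) := by positivity
  have hlt : (⌈Real.log ((T : ℝ) / B) / Real.log (1 + κ)⌉₊ : ℝ) <
      Real.log ((T : ℝ) / B) / Real.log (1 + κ) + 1 := Nat.ceil_lt_add_one hq0
  linarith


/-- Splitting `[1, Xb]` at `M₀ ≤ Xb`: `Icc 1 Xb = Icc 1 M₀ ∪ Ioc M₀ Xb` for sums. [folklore] -/
theorem sum_Icc_one_eq_add {M : Type*} [AddCommMonoid M] {M₀ Xb : ℕ} (h : M₀ ≤ Xb) (g : ℕ → M) :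
    ∑ m ∈ Icc 1 Xb, g m = ∑ m ∈ Icc 1 M₀, g m + ∑ m ∈ Ioc M₀ Xb, g m := by
  have h1 : Icc 1 Xb = Ioc 0 Xb := by ext m; simp [Nat.one_le_iff_ne_zero, Nat.pos_iff_ne_zero]
  have h2 : Icc 1 M₀ = Ioc 0 M₀ := by ext m; simp [Nat.one_le_iff_ne_zero, Nat.pos_iff_ne_zero]
  rw [h1, h2]
  exact (sum_Ioc_consecutive g (Nat.zero_le M₀) h).symm

/-- Restricting the `d₀`-sum to `(BP, TP]` when the summand vanishes outside. [folklore] -/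
theorem sum_Icc_eq_sum_Ioc_of_vanish {BP TP Xb : ℕ} (hTP : TP ≤ Xb) (G : ℕ → ℝ)
    (hG : ∀ d₀ ∈ Icc 1 Xb, G d₀ ≠ 0 → BP < d₀ ∧ d₀ ≤ TP) :
    ∑ d₀ ∈ Icc 1 Xb, G d₀ = ∑ d₀ ∈ Ioc BP TP, G d₀ := by
  classical
  rw [← Finset.sum_filter_ne_zero (s := Icc 1 Xb), ← Finset.sum_filter_ne_zero (s := Ioc BP TP)]
  refine Finset.sum_congr ?_ fun _ _ => rfl
  ext d₀
  simp only [Finset.mem_filter, Finset.mem_Icc, Finset.mem_Ioc]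
  constructor
  · rintro ⟨hd, hne⟩
    exact ⟨hG d₀ (Finset.mem_Icc.mpr hd) hne, hne⟩
  · rintro ⟨⟨h1, h2⟩, hne⟩
    exact ⟨⟨by omega, h2.trans hTP⟩, hne⟩

/-- Capping the `m`-range: `Σ_{m ∈ Ioc M₀ Xb} G = Σ_{m ∈ Ioc M₀ TM}` when `G` vanishes above `TM ≤ Xb`. [folklore] -/
theorem sum_Ioc_eq_sum_Ioc_of_vanish {M₀ TM Xb : ℕ} (hTM : TM ≤ Xb) (G : ℕ → ℝ)
    (hG : ∀ m ∈ Ioc M₀ Xb, G m ≠ 0 → m ≤ TM) :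
    ∑ m ∈ Ioc M₀ Xb, G m = ∑ m ∈ Ioc M₀ TM, G m := by
  classical
  rw [← Finset.sum_filter_ne_zero (s := Ioc M₀ Xb), ← Finset.sum_filter_ne_zero (s := Ioc M₀ TM)]
  refine Finset.sum_congr ?_ fun _ _ => rfl
  ext m
  simp only [Finset.mem_filter, Finset.mem_Ioc]
  constructor
  · rintro ⟨hm, hne⟩
    exact ⟨⟨hm.1, hG m (Finset.mem_Ioc.mpr hm) hne⟩, hne⟩
  · rintro ⟨⟨h1, h2⟩, hne⟩
    exact ⟨⟨h1, h2.trans hTM⟩, hne⟩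

/-- **Generic decomposition of the triple sum.**  `g` vanishes unless `BP < d₀ ≤ TP` and unless
`m ≤ TM`; `bP` is a monotone grid from `BP` to `TP ≤ Xb`, `bM` a monotone grid from `M₀` to `TM`
(`M₀ ≤ TM ≤ Xb`). [folklore] -/
theorem tripleSum_decomp (g : ℕ → ℕ → ℕ → ℝ) {Xb M₀ TM BP TP SP SM : ℕ} (bP bM : ℕ → ℕ)
    (hbP : Monotone bP) (hbM : Monotone bM) (hP0 : bP 0 = BP) (hPS : bP SP = TP)
    (hM0 : bM 0 = M₀) (hMS : bM SM = TM) (hTP : TP ≤ Xb) (hM₀ : M₀ ≤ TM) (hTMX : TM ≤ Xb)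
    (hg : ∀ d₀ d₁ m, g d₀ d₁ m ≠ 0 → BP < d₀ ∧ d₀ ≤ TP)
    (hgm : ∀ d₀ d₁ m, g d₀ d₁ m ≠ 0 → m ≤ TM) :
    ∑ d₀ ∈ Icc 1 Xb, ∑ d₁ ∈ Icc 1 Xb, ∑ m ∈ Icc 1 Xb, g d₀ d₁ m =
      (∑ d₀ ∈ Icc 1 Xb, ∑ d₁ ∈ Icc 1 Xb, ∑ m ∈ Icc 1 M₀, g d₀ d₁ m) +
      ∑ s ∈ range SP, ∑ j ∈ range SM,
        ∑ d₀ ∈ Ioc (bP s) (bP (s + 1)), ∑ d₁ ∈ Icc 1 Xb, ∑ m ∈ Ioc (bM j) (bM (j + 1)), g d₀ d₁ m := by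
  -- split `m` at `M₀` and cap at `TM`
  have step1 : ∀ d₀ d₁, ∑ m ∈ Icc 1 Xb, g d₀ d₁ m =
      ∑ m ∈ Icc 1 M₀, g d₀ d₁ m + ∑ m ∈ Ioc M₀ TM, g d₀ d₁ m := by
    intro d₀ d₁
    rw [sum_Icc_one_eq_add (hM₀.trans hTMX), sum_Ioc_eq_sum_Ioc_of_vanish hTMX _ (fun m _ hne => hgm d₀ d₁ m hne)]
  simp_rw [step1, Finset.sum_add_distrib]
  congr 1
  -- restrict `d₀` to `(BP, TP]`
  have step2 : ∑ d₀ ∈ Icc 1 Xb, ∑ d₁ ∈ Icc 1 Xb, ∑ m ∈ Ioc M₀ TM, g d₀ d₁ m =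
      ∑ d₀ ∈ Ioc BP TP, ∑ d₁ ∈ Icc 1 Xb, ∑ m ∈ Ioc M₀ TM, g d₀ d₁ m := by
    refine sum_Icc_eq_sum_Ioc_of_vanish hTP _ fun d₀ _ hne => ?_
    obtain ⟨d₁, _, hd₁⟩ := Finset.exists_ne_zero_of_sum_ne_zero hne
    obtain ⟨m, _, hm⟩ := Finset.exists_ne_zero_of_sum_ne_zero hd₁
    exact hg d₀ d₁ m hm
  rw [step2, ← hP0, ← hPS, sum_Ioc_eq_sum_range_blocks bP hbP _ SP]
  refine Finset.sum_congr rfl fun s _ => ?_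
  -- blocks in `m`, then exchange the order of summation
  have step3 : ∀ d₀ d₁, ∑ m ∈ Ioc M₀ TM, g d₀ d₁ m =
      ∑ j ∈ range SM, ∑ m ∈ Ioc (bM j) (bM (j + 1)), g d₀ d₁ m := by
    intro d₀ d₁
    rw [← hM0, ← hMS]
    exact sum_Ioc_eq_sum_range_blocks bM hbM _ SM
  simp_rw [step3]
  rw [Finset.sum_congr rfl fun d₀ _ => Finset.sum_comm]
  exact Finset.sum_comm

/-- Iterated triple sum over a product box as a sum over the product finset. [folklore] -/
theorem sum_sum_sum_eq_sum_prod (A B C : Finset ℕ) (g : ℕ → ℕ → ℕ → ℝ) :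
    ∑ a ∈ A, ∑ b ∈ B, ∑ c ∈ C, g a b c = ∑ p ∈ (A ×ˢ B) ×ˢ C, g p.1.1 p.1.2 p.2 := by
  rw [Finset.sum_product, Finset.sum_product]


/-- Powers of `1 + log x` are eventually below any positive power of `x` (natural `x`), with any
constant: `C (1 + log x)^k ≤ x^s` for `x ≥ X₀`. [folklore] -/
theorem eventually_mul_log_pow_le_rpow (C : ℝ) (k : ℕ) {s : ℝ} (hs : 0 < s) :
    ∀ᶠ x : ℕ in atTop, C * (1 + Real.log x) ^ k ≤ (x : ℝ) ^ s := by
  -- on `ℝ`: `(log x)^k = o(x^s)`, and `1 + log x ≤ 2 log x` for `log x ≥ 1`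
  have h1 : (fun x : ℝ => Real.log x ^ (k : ℝ)) =o[atTop] fun x => x ^ s :=
    isLittleO_log_rpow_rpow_atTop (k : ℝ) hs
  have hc : 0 < 1 / (|C| * 2 ^ k + 1) := by positivity
  have h2 := h1.def hc
  have h3 : ∀ᶠ x : ℝ in atTop, 1 ≤ Real.log x := Real.tendsto_log_atTop.eventually_ge_atTop 1
  have h4 : ∀ᶠ x : ℝ in atTop, C * (1 + Real.log x) ^ k ≤ x ^ s := by
    filter_upwards [h2, h3, eventually_ge_atTop (1 : ℝ)] with x hx hlog hx1
    have hlog0 : 0 ≤ Real.log x := by linarith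
    rw [Real.norm_of_nonneg (by positivity), Real.norm_of_nonneg (by positivity), Real.rpow_natCast] at hx
    have hxs : 0 ≤ x ^ s := by positivity
    -- `(1 + log x)^k ≤ (2 log x)^k`
    have h5 : (1 + Real.log x) ^ k ≤ (2 * Real.log x) ^ k :=
      pow_le_pow_left₀ (by linarith) (by linarith) k
    rw [mul_pow] at h5
    have h6 : C * (1 + Real.log x) ^ k ≤ |C| * (2 ^ k * Real.log x ^ k) := by
      calc C * (1 + Real.log x) ^ k ≤ |C| * (1 + Real.log x) ^ k :=
            mul_le_mul_of_nonneg_right (le_abs_self C) (by positivity)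
        _ ≤ |C| * (2 ^ k * Real.log x ^ k) := mul_le_mul_of_nonneg_left h5 (abs_nonneg C)
    have h7 : |C| * (2 ^ k * Real.log x ^ k) ≤ x ^ s := by
      have h8 : Real.log x ^ k ≤ 1 / (|C| * 2 ^ k + 1) * x ^ s := hx
      have h9 : |C| * 2 ^ k * (1 / (|C| * 2 ^ k + 1)) ≤ 1 := by
        rw [← mul_div_assoc, mul_one, div_le_one (by positivity)]; linarith
      calc |C| * (2 ^ k * Real.log x ^ k) = (|C| * 2 ^ k) * Real.log x ^ k := by ring
        _ ≤ (|C| * 2 ^ k) * (1 / (|C| * 2 ^ k + 1) * x ^ s) :=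
            mul_le_mul_of_nonneg_left h8 (by positivity)
        _ = (|C| * 2 ^ k * (1 / (|C| * 2 ^ k + 1))) * x ^ s := by ring
        _ ≤ 1 * x ^ s := mul_le_mul_of_nonneg_right h9 hxs
        _ = x ^ s := one_mul _
    linarith
  exact h4.natCast_atTop (p := fun y : ℝ => C * (1 + Real.log y) ^ k ≤ y ^ s)

end GeometricGrid

end Literature.NumberTheory.Sieve
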